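import Summits.Ventures.AbcSig.Rows.Bridge
import Summits.Ventures.AbcSig.Rows.C2aL229A0X
import Summits.Ventures.AbcSig.Rows.C2aL229A0XAB

/-!
# Venture AbcSig — CELL `C2aL229A0`: the census statement `Rows.C2aCellRed 229 (fun a => a = 0) ∅` from the two row theorems

HONEST FRAMING. COMPUTATION cell `pub-abcsig`; CONDITIONAL theorem; no claim on ABC or any summit. Hypotheses exactly as
in `Rows/C2aL229A0X.lean` and `Rows/C2aL229A0XAB.lean`: `BS04Package` (CITED), `DataComplete …` (COMPUTED level files), `EisPackage` (CITED) and `Refines` (COMPUTED) for the M6 orbits discharged in the kernel, and the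
rows' per-orbit exclusions for `famB` as universally quantified hypotheses (CITED: the census
row's certificates). Conclusion = p1's census predicate (`Rows/Statements.lean`), all four coprime coefficient
distributions `A·B = 2^a·229^m`, reduced exponents `a < n`, `m < n` (RULING H1). GENERATED by p-lean gen/make_rows.py
(after plean/make_cell_bridges.py).
-/

namespace Summit.Ventures.AbcSig

/-- Cell `C2aL229A0` (M6 orbits discharged in the kernel): `Rows.C2aCellRed 229 (fun a => a = 0) ∅` under the rows' hypotheses. -/
theorem xcell_C2aL229A0 (M : NewformModel) (hP : M.BS04Package)
    (hE : M.EisPackage)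
    (hD458 : M.DataComplete 458 level458Orbits)
    (hD7328 : M.DataComplete 7328 level7328Orbits)
    (hR_orbit_458_5 : M.Refines 458 orbit_458_5 m6X_458_5)
    (hX_orbit_7328_8 : ∀ n m : ℕ, n ∈ ([13] : List ℕ) → M.Excludes 7328 orbit_7328_8 (famB (2 ^ 0 * 229 ^ m) n (fun _ _ => True)))
    (hX_orbit_7328_9 : ∀ n m : ℕ, n ∈ ([13] : List ℕ) → M.Excludes 7328 orbit_7328_9 (famB (2 ^ 0 * 229 ^ m) n (fun _ _ => True)))
    (hX_orbit_7328_10 : ∀ n m : ℕ, n ∈ ([13] : List ℕ) → M.Excludes 7328 orbit_7328_10 (famB (2 ^ 0 * 229 ^ m) n (fun _ _ => True))) :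
    Rows.C2aCellRed 229 (fun a => a = 0) ∅ :=
  C2aCellRed_of_rows 229 (by norm_num) (by norm_num) _ _
    (fun n hn h11 hnℓ _ a m (ha : a = 0) han hm hmn x y z h1 h2 => by
      subst ha
      exact
 xrow_C2aL229A0 M hP hE hD458 hD7328 hR_orbit_458_5 n hn h11 hnℓ m hm hmn (hX_orbit_7328_8 n m) (hX_orbit_7328_9 n m) (hX_orbit_7328_10 n m) x y z h1 h2)
    (fun n hn h11 hnℓ _ a m (ha : a = 0) han hm hmn x y z h1 h2 => by
      subst ha
      exact
 xrow_C2aL229A0AB M hP hE hD458 hD7328 hR_orbit_458_5 n hn h11 hnℓ m hm hmn (hX_orbit_7328_8 n m) (hX_orbit_7328_9 n m) (hX_orbit_7328_10 n m) x y z h1 h2)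

end Summit.Ventures.AbcSig
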